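import Mathlib.Analysis.Fourier.AddCircle
import Literature.Analysis.Toeplitz.OneSidedSeries
import Literature.Analysis.Toeplitz.WindingDecay
import HarnessLib

/-!
# Symbols on the circle with geometrically decaying Fourier coefficients

Topic `Analysis/Toeplitz`, namespace `Literature.Analysis.Toeplitz`. The two-sided part of the
symbol calculus for the strong Szegő limit theorem (`StrongSzegoGeometric.lean`;
Deift–Its–Krasovsky 2013, §3): for a continuous `2π`-periodic `V : ℝ → ℂ` with Fourier
coefficients `v k = circleCoeff V k`, `‖v k‖ ≤ C r^{|k|}`, `r < 1`,

* `hasSum_circleCoeff` — `V θ = ∑_{k ∈ ℤ} v k e^{ikθ}` pointwise (Mathlib's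
  `has_pointwise_sum_fourier_series_of_summable` on `AddCircle (2π)`, transported along
  `Function.Periodic.lift` and `fourierCoeff (lift V) = circleCoeff V`);
* the split `V = v 0 + V₊ + V₋` with `V₊ θ = ser (posSeq v) θ`, `V₋ θ = ser (negSeq v) (-θ)`
  (`eq_const_add_ser_add_ser`), `posSeq v n = v n`, `negSeq v n = v (-n)` for `n ≥ 1`, `0` at `0`;
* **the Fourier coefficients of `e^V`** (`circleCoeff_exp_eq_twoSided`): with the exponential
  sequences `E₊ = expSeq (posSeq v)` and `E₋ = expSeq (negSeq v)` of `OneSidedSeries`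
  (`e^{V₊} = ∑ E₊ q e^{iqθ}`, `e^{V₋} = ∑ E₋ n e^{-inθ}`),

    `circleCoeff (exp ∘ V) k = e^{v 0} · twoSided E₊ E₋ k`,

  where `twoSided E₊ E₋ k = ∑_q E₊ q E₋ (q - k)` is the coefficient sequence of the Toeplitz
  matrix `U(E₋) L(E₊)` (`ToeplitzHankel.imul_upperT_lowerT_eq_toeplitzInf`). This identifies the
  Toeplitz matrices `T_n(e^V)` of the strong Szegő limit theorem with finite sections of
  `e^{v 0} U(E₋) L(E₊)`.

## References

* P. Deift, A. Its, I. Krasovsky, Comm. Pure Appl. Math. 66 (2013) 1360–1438, §3.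
-/

noncomputable section

open Finset Filter Complex MeasureTheory intervalIntegral
open scoped _root_.Topology BigOperators Real

namespace Literature.Analysis.Toeplitz

/-! ### The Fourier series of a continuous periodic function with summable coefficients -/

section Fourier

variable {V : ℝ → ℂ}

/-- The lift of a continuous periodic function to the circle is continuous. [folklore] -/
theorem continuous_periodic_lift (hV : Continuous V) (hper : Function.Periodic V (2 * Real.pi)) :
    Continuous (hper.lift : AddCircle (2 * Real.pi) → ℂ) := by
  have h : (hper.lift : AddCircle (2 * Real.pi) → ℂ) ∘
      (QuotientAddGroup.mk : ℝ → AddCircle (2 * Real.pi)) = V := by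
    funext x; exact hper.lift_coe x
  rw [(QuotientAddGroup.isQuotientMap_mk _).continuous_iff, h]
  exact hV

/-- The lift as a bundled continuous map on `AddCircle (2π)`. [folklore] -/
def liftC (hV : Continuous V) (hper : Function.Periodic V (2 * Real.pi)) :
    C(AddCircle (2 * Real.pi), ℂ) :=
  ⟨hper.lift, continuous_periodic_lift hV hper⟩

/-- The lift agrees with `V` on representatives. [folklore] -/
theorem liftC_apply_coe (hV : Continuous V) (hper : Function.Periodic V (2 * Real.pi)) (θ : ℝ) :
    liftC hV hper (θ : AddCircle (2 * Real.pi)) = V θ :=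
  hper.lift_coe θ

/-- `0 < 2π` as a `Fact`, for Mathlib's Fourier theory on `AddCircle (2π)`. [folklore] -/
theorem fact_two_pi_pos : Fact (0 < 2 * Real.pi) := ⟨Real.two_pi_pos⟩

attribute [local instance] fact_two_pi_pos

/-- **The Fourier coefficients of the lift are the `circleCoeff`s**:
`fourierCoeff (lift V) k = (2π)⁻¹ ∫_{-π}^{π} e^{-ikθ} V θ dθ`. [folklore] -/
theorem fourierCoeff_liftC (hV : Continuous V) (hper : Function.Periodic V (2 * Real.pi)) (k : ℤ) :
    fourierCoeff (liftC hV hper) k = circleCoeff V k := by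
  rw [fourierCoeff_eq_intervalIntegral (liftC hV hper) k (-Real.pi), circleCoeff,
    show -Real.pi + 2 * Real.pi = Real.pi by ring, Complex.real_smul]
  congr 1
  · push_cast; ring
  · refine intervalIntegral.integral_congr fun θ _ => ?_
    simp only [liftC_apply_coe, fourier_coe_apply, smul_eq_mul]
    congr 1
    congr 1
    push_cast
    field_simp

/-- **Pointwise Fourier series**: a continuous `2π`-periodic function with absolutely summable
Fourier coefficients is the sum of its Fourier series at every point,
`V θ = ∑_{k ∈ ℤ} (circleCoeff V k) e^{ikθ}` (Mathlib's `has_pointwise_sum_fourier_series_of_summable`). [folklore] -/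
theorem hasSum_circleCoeff (hV : Continuous V) (hper : Function.Periodic V (2 * Real.pi))
    (hs : Summable fun k => ‖circleCoeff V k‖) (θ : ℝ) :
    HasSum (fun k : ℤ => circleCoeff V k * Complex.exp (k * θ * I)) (V θ) := by
  have hsum : Summable (fourierCoeff (liftC hV hper)) := by
    refine Summable.of_norm ?_
    exact hs.congr fun k => by rw [fourierCoeff_liftC]
  have h := has_pointwise_sum_fourier_series_of_summable hsum (θ : AddCircle (2 * Real.pi))
  rw [liftC_apply_coe] at h
  refine h.congr_fun fun k => ?_
  rw [fourierCoeff_liftC, fourier_coe_apply, smul_eq_mul]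
  congr 1
  congr 1
  push_cast
  field_simp

end Fourier

/-! ### The split `V = v₀ + V₊ + V₋` -/

/-- The **positive-frequency sequence** `posSeq v n = v n` for `n ≥ 1`, `0` at `n = 0`. [folklore] -/
def posSeq (v : ℤ → ℂ) : ℕ → ℂ := fun n => if n = 0 then 0 else v n

/-- The **negative-frequency sequence** `negSeq v n = v (-n)` for `n ≥ 1`, `0` at `n = 0`. [folklore] -/
def negSeq (v : ℤ → ℂ) : ℕ → ℂ := fun n => if n = 0 then 0 else v (-(n : ℤ))

/-- `posSeq v 0 = 0`. [folklore] -/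
@[simp] theorem posSeq_zero (v : ℤ → ℂ) : posSeq v 0 = 0 := rfl

/-- `negSeq v 0 = 0`. [folklore] -/
@[simp] theorem negSeq_zero (v : ℤ → ℂ) : negSeq v 0 = 0 := rfl

/-- `posSeq v n = v n` for `n ≠ 0`. [folklore] -/
theorem posSeq_of_ne_zero (v : ℤ → ℂ) {n : ℕ} (h : n ≠ 0) : posSeq v n = v n := if_neg h

/-- `negSeq v n = v (-n)` for `n ≠ 0`. [folklore] -/
theorem negSeq_of_ne_zero (v : ℤ → ℂ) {n : ℕ} (h : n ≠ 0) : negSeq v n = v (-(n : ℤ)) := if_neg h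

/-- `‖posSeq v n‖ ≤ ‖v n‖`. [folklore] -/
theorem norm_posSeq_le (v : ℤ → ℂ) (n : ℕ) : ‖posSeq v n‖ ≤ ‖v n‖ := by
  rcases Nat.eq_zero_or_pos n with rfl | hn
  · simp
  · rw [posSeq_of_ne_zero v hn.ne']

/-- `‖negSeq v n‖ ≤ ‖v (-n)‖`. [folklore] -/
theorem norm_negSeq_le (v : ℤ → ℂ) (n : ℕ) : ‖negSeq v n‖ ≤ ‖v (-(n : ℤ))‖ := by
  rcases Nat.eq_zero_or_pos n with rfl | hn
  · simp
  · rw [negSeq_of_ne_zero v hn.ne']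

/-- `posSeq v ∈ ℓ¹` if `v ∈ ℓ¹(ℤ)`. [folklore] -/
theorem summable_norm_posSeq {v : ℤ → ℂ} (hs : Summable fun k => ‖v k‖) :
    Summable fun n => ‖posSeq v n‖ :=
  Summable.of_nonneg_of_le (fun _ => norm_nonneg _) (norm_posSeq_le v)
    (hs.comp_injective Nat.cast_injective)

/-- `negSeq v ∈ ℓ¹` if `v ∈ ℓ¹(ℤ)`. [folklore] -/
theorem summable_norm_negSeq {v : ℤ → ℂ} (hs : Summable fun k => ‖v k‖) :
    Summable fun n => ‖negSeq v n‖ :=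
  Summable.of_nonneg_of_le (fun _ => norm_nonneg _) (norm_negSeq_le v)
    (hs.comp_injective (fun m n hmn => by simpa using hmn : Function.Injective fun n : ℕ => -(n : ℤ)))

section Split

variable {v : ℤ → ℂ} {C r : ℝ}

/-- A two-sided geometric bound gives a geometric bound for `posSeq`. [folklore] -/
theorem isGeom_posSeq (hv : ∀ k, ‖v k‖ ≤ C * r ^ k.natAbs) : IsGeom r C (posSeq v) := by
  have hC : 0 ≤ C := by
    have := hv 0; simp only [Int.natAbs_zero, pow_zero, mul_one] at this; exact (norm_nonneg _).trans this
  intro n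
  rcases Nat.eq_zero_or_pos n with rfl | hn
  · simpa using hC
  · rw [posSeq_of_ne_zero v hn.ne']
    simpa using hv n

/-- A two-sided geometric bound gives a geometric bound for `negSeq`. [folklore] -/
theorem isGeom_negSeq (hv : ∀ k, ‖v k‖ ≤ C * r ^ k.natAbs) : IsGeom r C (negSeq v) := by
  have hC : 0 ≤ C := by
    have := hv 0; simp only [Int.natAbs_zero, pow_zero, mul_one] at this; exact (norm_nonneg _).trans this
  intro n
  rcases Nat.eq_zero_or_pos n with rfl | hn
  · simpa using hC
  · rw [negSeq_of_ne_zero v hn.ne']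
    simpa using hv (-(n : ℤ))

/-- A two-sided geometric bound makes the coefficients absolutely summable (`r < 1`). [folklore] -/
theorem summable_norm_of_geom (hv : ∀ k, ‖v k‖ ≤ C * r ^ k.natAbs) (hr : 0 ≤ r) (hr1 : r < 1) :
    Summable fun k => ‖v k‖ := by
  have hnat : Summable fun n : ℕ => C * r ^ n := (summable_geometric_of_lt_one hr hr1).mul_left C
  refine Summable.of_nonneg_of_le (fun k => norm_nonneg _) hv ?_
  refine summable_int_iff_summable_nat_and_neg.2 ⟨?_, ?_⟩
  · simpa using hnat
  · simpa using hnat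

/-- **The split `V θ = v 0 + V₊ θ + V₋ θ`**: if `V θ = ∑_k v k e^{ikθ}` with `v ∈ ℓ¹(ℤ)`, then
`V θ = v 0 + ser (posSeq v) θ + ser (negSeq v) (-θ)`. [folklore] -/
theorem eq_const_add_ser_add_ser (hs : Summable fun k => ‖v k‖) {θ : ℝ} {w : ℂ}
    (h : HasSum (fun k : ℤ => v k * Complex.exp (k * θ * I)) w) :
    w = v 0 + ser (posSeq v) θ + ser (negSeq v) (-θ) := by
  set f : ℤ → ℂ := fun k => v k * Complex.exp (k * θ * I) with hf
  have hfn : Summable fun k => ‖f k‖ := by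
    refine hs.congr fun k => ?_
    rw [hf]; simp only
    rw [norm_mul, show (k : ℂ) * θ * I = ((k * θ : ℝ) : ℂ) * I by push_cast; ring,
      Complex.norm_exp_ofReal_mul_I, mul_one]
  have hpos : Summable fun n : ℕ => ‖f n‖ := hfn.comp_injective Nat.cast_injective
  have hneg : Summable fun n : ℕ => ‖f (-(n : ℤ))‖ :=
    hfn.comp_injective fun m n hmn => by simpa using hmn
  have hsplit := (hpos.of_norm.hasSum).of_nat_of_neg hneg.of_norm.hasSum
  have hw : w = (∑' n : ℕ, f n) + (∑' n : ℕ, f (-(n : ℤ))) - f 0 := h.unique hsplit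
  -- `ser (posSeq v) θ = ∑_{n ≥ 0} f n - f 0`, `ser (negSeq v) (-θ) = ∑_{n ≥ 0} f (-n) - f 0`
  have hp : ser (posSeq v) θ = (∑' n : ℕ, f n) - f 0 := by
    rw [ser, hpos.of_norm.tsum_eq_zero_add]
    have hps : Summable fun n : ℕ => posSeq v n * Complex.exp (θ * I) ^ n :=
      (summable_norm_ser_term (summable_norm_posSeq hs) θ).of_norm
    rw [hps.tsum_eq_zero_add, posSeq_zero, zero_mul, zero_add, Nat.cast_zero, add_sub_cancel_left]
    refine tsum_congr fun n => ?_
    rw [posSeq_of_ne_zero v (Nat.succ_ne_zero n), hf]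
    simp only
    rw [← Complex.exp_nat_mul]
    congr 2; push_cast; ring
  have hn : ser (negSeq v) (-θ) = (∑' n : ℕ, f (-(n : ℤ))) - f 0 := by
    rw [ser, hneg.of_norm.tsum_eq_zero_add]
    have hns : Summable fun n : ℕ => negSeq v n * Complex.exp ((-θ : ℝ) * I) ^ n :=
      (summable_norm_ser_term (summable_norm_negSeq hs) (-θ)).of_norm
    rw [hns.tsum_eq_zero_add, negSeq_zero, zero_mul, zero_add, Nat.cast_zero, neg_zero, add_sub_cancel_left]
    refine tsum_congr fun n => ?_
    rw [negSeq_of_ne_zero v (Nat.succ_ne_zero n), hf]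
    simp only
    rw [← Complex.exp_nat_mul]
    congr 2; push_cast; ring
  rw [hw, hp, hn]
  have : f 0 = v 0 := by rw [hf]; simp
  rw [this]; ring

end Split

/-! ### The Fourier coefficients of a product of one-sided series -/

section Product

variable {x y : ℕ → ℂ}

/-- **Coefficients of `(∑ x q e^{iqθ})(∑ y n e^{-inθ})`**: the `k`-th Fourier coefficient of
`ser x θ · ser y (-θ)` is `twoSided x y k = ∑_q x q y (q - k)` (termwise integration of the
absolutely convergent double series; the pairs `q - n = k` survive). [folklore] -/
theorem circleCoeff_ser_mul_ser_neg (hx : Summable fun n => ‖x n‖) (hy : Summable fun n => ‖y n‖)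
    (k : ℤ) : circleCoeff (fun θ => ser x θ * ser y (-θ)) k = twoSided x y k := by
  have hprod : ∀ θ : ℝ, HasSum (fun p : ℕ × ℕ => (x p.1 * Complex.exp (θ * I) ^ p.1) *
      (y p.2 * Complex.exp (((-θ : ℝ) : ℂ) * I) ^ p.2)) (ser x θ * ser y (-θ)) := by
    intro θ
    have h3 := summable_mul_of_summable_norm (summable_norm_ser_term hx θ) (summable_norm_ser_term hy (-θ))
    have h4 := HasSum.mul (hasSum_ser hx θ) (hasSum_ser hy (-θ)) h3
    convert h4 using 3
  have hbound : ∀ (p : ℕ × ℕ) (θ : ℝ), ‖Complex.exp (-(k * θ * I)) *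
      ((x p.1 * Complex.exp (θ * I) ^ p.1) * (y p.2 * Complex.exp (((-θ : ℝ) : ℂ) * I) ^ p.2))‖ ≤
      ‖x p.1‖ * ‖y p.2‖ := by
    intro p θ
    rw [norm_mul, show -((k : ℂ) * θ * I) = ((-(k * θ) : ℝ) : ℂ) * I by push_cast; ring,
      Complex.norm_exp_ofReal_mul_I, one_mul, norm_mul, norm_ser_term, norm_ser_term]
  have hbs : Summable fun p : ℕ × ℕ => ‖x p.1‖ * ‖y p.2‖ :=
    summable_mul_of_summable_norm (f := fun n => ‖x n‖) (g := fun n => ‖y n‖)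
      (hx.congr fun n => (norm_norm _).symm) (hy.congr fun n => (norm_norm _).symm)
  -- termwise integration
  have hint : HasSum (fun p : ℕ × ℕ => ∫ θ in (-Real.pi)..Real.pi, Complex.exp (-(k * θ * I)) *
      ((x p.1 * Complex.exp (θ * I) ^ p.1) * (y p.2 * Complex.exp (((-θ : ℝ) : ℂ) * I) ^ p.2)))
      (∫ θ in (-Real.pi)..Real.pi, Complex.exp (-(k * θ * I)) * (ser x θ * ser y (-θ))) := by
    refine intervalIntegral.hasSum_integral_of_dominated_convergence
      (fun p _ => ‖x p.1‖ * ‖y p.2‖) (fun p => ?_) (fun p => ?_) ?_ ?_ ?_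
    · exact Continuous.aestronglyMeasurable (by fun_prop)
    · exact Eventually.of_forall fun θ _ => hbound p θ
    · exact Eventually.of_forall fun θ _ => hbs
    · exact intervalIntegrable_const
    · exact Eventually.of_forall fun θ _ => (hprod θ).mul_left _
  -- the individual integrals
  have hterm : ∀ q n : ℕ, (∫ θ in (-Real.pi)..Real.pi, Complex.exp (-(k * θ * I)) *
      ((x q * Complex.exp (θ * I) ^ q) * (y n * Complex.exp (((-θ : ℝ) : ℂ) * I) ^ n))) =
      x q * y n * (if ((q : ℤ) - n - k) = 0 then 2 * (Real.pi : ℂ) else 0) := by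
    intro q n
    have hfun : (fun θ : ℝ => Complex.exp (-(k * θ * I)) *
        ((x q * Complex.exp (θ * I) ^ q) * (y n * Complex.exp (((-θ : ℝ) : ℂ) * I) ^ n))) =
        fun θ : ℝ => x q * y n * Complex.exp ((((q : ℤ) - n - k : ℤ) : ℂ) * θ * I) := by
      funext θ
      rw [← Complex.exp_nat_mul, ← Complex.exp_nat_mul,
        show Complex.exp (-(k * θ * I)) * (x q * Complex.exp (q * (θ * I)) *
          (y n * Complex.exp (n * (((-θ : ℝ) : ℂ) * I)))) =
          x q * y n * (Complex.exp (-(k * θ * I)) *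
            Complex.exp (q * (θ * I)) * Complex.exp (n * (((-θ : ℝ) : ℂ) * I))) by ring,
        ← Complex.exp_add, ← Complex.exp_add]
      congr 2; push_cast; ring
    rw [hfun, intervalIntegral.integral_const_mul, integral_exp_int_mul_I]
  -- summing fibrewise over `q = p.1`
  have hfib : ∀ q : ℕ, HasSum (fun n : ℕ => ∫ θ in (-Real.pi)..Real.pi, Complex.exp (-(k * θ * I)) *
      ((x q * Complex.exp (θ * I) ^ q) * (y n * Complex.exp (((-θ : ℝ) : ℂ) * I) ^ n)))
      ((2 * Real.pi) * (x q * extendZ y ((q : ℤ) - k))) := by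
    intro q
    simp_rw [hterm q]
    by_cases hqk : k ≤ (q : ℤ)
    · -- exactly one term, `n = (q - k).toNat`
      obtain ⟨n₀, hn₀⟩ : ∃ n₀ : ℕ, (n₀ : ℤ) = (q : ℤ) - k := ⟨((q : ℤ) - k).toNat,
        Int.toNat_of_nonneg (sub_nonneg.2 hqk)⟩
      have heq : (fun n : ℕ => x q * y n * (if ((q : ℤ) - n - k) = 0 then 2 * (Real.pi : ℂ) else 0)) =
          fun n => if n = n₀ then (2 * Real.pi) * (x q * y n₀) else 0 := by
        funext n
        by_cases h : n = n₀
        · subst h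
          rw [if_pos (by omega), if_pos rfl]; ring
        · rw [if_neg (by omega), if_neg h, mul_zero]
      rw [heq, ← hn₀, extendZ_natCast]
      exact hasSum_ite_eq n₀ _
    · -- no term
      have heq : (fun n : ℕ => x q * y n * (if ((q : ℤ) - n - k) = 0 then 2 * (Real.pi : ℂ) else 0)) =
          fun _ => 0 := by
        funext n; rw [if_neg (by omega), mul_zero]
      rw [heq, extendZ_of_neg y (by omega), mul_zero, mul_zero]
      exact hasSum_zero
  have htot := hint.prod_fiberwise hfib
  have h2π : (2 * Real.pi : ℂ) ≠ 0 := by exact_mod_cast (mul_pos two_pos Real.pi_pos).ne'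
  rw [circleCoeff, ← htot.tsum_eq, twoSided, tsum_mul_left, ← mul_assoc, inv_mul_cancel₀ h2π, one_mul]

end Product

/-! ### The Fourier coefficients of `e^V` -/

section ExpSymbol

variable {V : ℝ → ℂ} {C r : ℝ}

/-- **The Fourier coefficients of `e^V` in Wiener–Hopf form.** Let `V` be continuous and
`2π`-periodic with `‖circleCoeff V k‖ ≤ C r^{|k|}`, `0 ≤ r < 1`, `v = circleCoeff V`,
`E₊ = expSeq (posSeq v)`, `E₋ = expSeq (negSeq v)`. Then for every `k ∈ ℤ`,
`circleCoeff (exp ∘ V) k = e^{v 0} · twoSided E₊ E₋ k`, i.e. `e^V = e^{v₀} e^{V₊} e^{V₋}` with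
`e^{V₊} = ∑ E₊ q e^{iqθ}`, `e^{V₋} = ∑ E₋ n e^{-inθ}`, and the `k`-th coefficient of the product
collects the pairs `q - n = k` (Deift–Its–Krasovsky 2013, §3: `φ = φ₊ φ₋`, `φ± = e^{V±}`). [folklore] -/
theorem circleCoeff_exp_eq_twoSided (hV : Continuous V) (hper : Function.Periodic V (2 * Real.pi))
    (hv : ∀ k, ‖circleCoeff V k‖ ≤ C * r ^ k.natAbs) (hr : 0 ≤ r) (hr1 : r < 1) (k : ℤ) :
    circleCoeff (fun θ => Complex.exp (V θ)) k =
      Complex.exp (circleCoeff V 0) *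
        twoSided (expSeq (posSeq (circleCoeff V))) (expSeq (negSeq (circleCoeff V))) k := by
  -- a rate `σ ∈ (r, 1)` to get absolute summability of `E±`
  have hσ : 0 < (r + 1) / 2 := by linarith
  have hσ1 : (r + 1) / 2 < 1 := by linarith
  have hrσ : r < (r + 1) / 2 := by linarith
  have hps : IsSumW ((r + 1) / 2) (posSeq (circleCoeff V)) :=
    (isSumW_of_isGeom (isGeom_posSeq hv) hr hσ hrσ).1
  have hns : IsSumW ((r + 1) / 2) (negSeq (circleCoeff V)) :=
    (isSumW_of_isGeom (isGeom_negSeq hv) hr hσ hrσ).1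
  have hEp1 := summable_norm_expSeq hps hσ hσ1
  have hEm1 := summable_norm_expSeq hns hσ hσ1
  have hvs : Summable fun k => ‖circleCoeff V k‖ := summable_norm_of_geom hv hr hr1
  -- `exp (V θ) = e^{v 0} · ser E₊ θ · ser E₋ (-θ)`
  have hexp : (fun θ : ℝ => Complex.exp (V θ)) = fun θ => Complex.exp (circleCoeff V 0) *
      (ser (expSeq (posSeq (circleCoeff V))) θ * ser (expSeq (negSeq (circleCoeff V))) (-θ)) := by
    funext θ
    have hsplit := eq_const_add_ser_add_ser hvs (hasSum_circleCoeff hV hper hvs θ)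
    rw [hsplit, Complex.exp_add, Complex.exp_add, exp_ser (hps.summable_norm hσ hσ1.le),
      exp_ser (hns.summable_norm hσ hσ1.le), mul_assoc]
  rw [hexp, circleCoeff_const_mul, circleCoeff_ser_mul_ser_neg hEp1 hEm1]

end ExpSymbol

end Literature.Analysis.Toeplitz
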